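import Mathlib
import Summits.Ventures.HodgeRepro2.LiuOscillator
import Summits.Ventures.HodgeRepro2.T6B5Datum

/-!
# T6B5CentralHyp — Tier 6, sub-goal B5: the scalar isometries and the displayed central-character sentence of
Liu's Appendix D.1 (Step 3)

TIER4 §B5 Proposition B5.3(e) (the central-character constraint on any level) is, at v0.4 of the owner file, the one
clause of §B5 that is «beyond its generic kernel form»: the generic kernel lemma
`LevelPositivity.central_character_eq_one` (p388821) and its Schur-supplied form
`T5CentralCharacterLevel.centralCharacter_eq_one_of_invariants_ne_bot` (p393201) are in the tree, but the B5 datum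
`LiuAlbaneseDatum` (T6B5Datum.lean) carries no scalar action, so TIER4's instance «χ(z) = 1 for every scalar
z ∈ K' ∩ (A_E^∞)^1» could not be STATED over it. This file supplies the two missing pieces, DATA and DISPLAY:

* `ScalarDatum 𝓛` — DATA ONLY: the homomorphism `(A_E^∞)^1 → Z(G(A_F^∞))`, `z = (z_v)_v ↦` the isometry acting on
  `V_v` by the scalar `z_v` (TIER4 §B5 Prop. B5.3(e); p2's `Liu.oneFinIdeles K c` is `(A_E^∞)^1`);
* `Hyp.Liu2021_AppD1_Step3 𝓛 𝓢` — the displayed sentence of Liu 2021 Appendix D.1 Step 3 (p. 125 ll. 24–25): the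
  oscillator representation has central character `χ`, carried for the adèlic representation `ω(μ, ε, χ)` of the
  datum as ‹the scalars `z ∈ (A_E^∞)^1` act on `ω(μ, ε, χ)` by `χ(z)`› (a gloss, not a quote).

`T6B5Central.lean` consumes the display (Prop. B5.3(e) at every level of `B5_main`'s conclusion, and the
identification of the printed `χ` with Schur's central character); `T6B5CentralToy.lean` witnesses it jointly with
Def. 4.11 and the Thm. 4.18 displays (README §10.5(ii)(c),(d)). Journal page layer
`paper:liu2021-fourier-jacobi-cycles-arithmetic-relative-trace-formula` (Y. Liu, Cambridge J. Math. 9 (2021), no. 1,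
1–147; `p00NN` = journal page NN, `l.` = layer line), re-opened by t6-p8 (gen 12) in its own `lit read` copy.
v2 (gen 12, 10:0xZ): t6-lit's QA-t6lit-101 form nits n1–n3 applied (docstring only; the `structure` and the `def`
byte-identical to v1 7250609f…).
README §8(d): uses an L-value-free non-vanishing device: NO.
-/

namespace Summit.Ventures.HodgeRepro2.T6.B5Datum

open Summit.Ventures.HodgeRepro2.ShimuraData

universe u

variable {K : Type u} [Field K] [NumberField K] [NumberField.IsCMField K] {c : Liu.IdeleConjugation K}
  {χEF : Liu.QuadraticCharacter K c}

/-- The scalar isometries of the B5 datum (DATA ONLY, no `Prop` field): the group homomorphism from `(A_E^∞)^1`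
(p2's `Liu.oneFinIdeles K c`, the finite idèles `x` of `E` with `x · x^c = 1`) to the CENTRE of `G(A_F^∞)`, sending
`z = (z_v)_v` to the isometry of `V` acting on each `V_v` by the scalar `z_v` (TIER4 §B5 Prop. B5.3(e): «z = (z_v)_v
with z_v ∈ E_v^1 acting on V_v by the scalar z_v»). A scalar isometry commutes with every isometry, so the map is
carried into `Subgroup.center 𝓛.G`; which elements of the centre are scalars is part of the datum (the print's
`E^1 ⊂ U(V)`, Liu 2021 p. 125 l. 11, layer p0125 l. 11 «E 1 := {x ∈ E | xxc = 1}» ‹E^1 := {x ∈ E | x x^c = 1}›,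
the superscripts restored). -/
structure ScalarDatum (𝓛 : LiuAlbaneseDatum K c χEF) where
  /-- `(A_E^∞)^1 → Z(G(A_F^∞))`, `z ↦ (the scalar isometry z_v)_v`. -/
  scalar : ↥(Liu.oneFinIdeles K c) →* Subgroup.center 𝓛.G

end Summit.Ventures.HodgeRepro2.T6.B5Datum

namespace Summit.Ventures.HodgeRepro2.T6.Hyp

open Summit.Ventures.HodgeRepro2.ShimuraData Summit.Ventures.HodgeRepro2.T6.B5Datum

universe u

variable {K : Type u} [Field K] [NumberField K] [NumberField.IsCMField K] {c : Liu.IdeleConjugation K}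
  {χEF : Liu.QuadraticCharacter K c}

/-- [cite: Liu2021, Appendix D.1 «Oscillator representations of local unitary groups», Step 3 of the construction,
Cambridge J. Math. 9 (2021) p. 125 ll. 24–25, layer paper:liu2021-fourier-jacobi-cycles-arithmetic-relative-trace-formula
p0125 ll. 24–25 (setting: p0125 ll. 10–13 «Let F be a local ﬁeld whose characteristic is not 2. Let E be an étale F
algebra of rank 2. Denote by c the unique nontrivial involution on E that ﬁxes F , and put E − := {x ∈ E | x + xc = 0}
and E 1 := {x ∈ E | xxc = 1}. Let V, ( , )V be a (non-degenerate) hermitian space over E (with respect to c) of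
rank n ⩾ 2.»)] «Step 3: Choose a character χ : E 1 → C1 . Let ω(μ, ε, χ) be the maximal
quotient of the representation ω(ε, μ) of U(V) with central character χ.» (layer ll. 24–25; the layer prints the
superscripts of `E^1`, `ℂ^1` as «E 1», «C1»)
[display: the printed sentence is LOCAL (one place `v`: `F = F_v`, `E = E_v`, `U(V) = U(V_v)`, `χ = χ_v`) and
DEFINES `ω(μ_v, ε_v, χ_v)` as the maximal quotient of `ω(ε_v, μ_v)` on which the centre `E_v^1 ⊂ U(V_v)` acts by the
scalar `χ_v`. The B5 datum carries only the ADÈLIC representation `ω(μ, ε, χ) := ⊗'_v ω(μ_v, ε_v, χ_v)` (Def. 4.11,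
p0046 ll. 56–58) on `G(A_F^∞)`, not its local factors; the display therefore states the adèlic consequence of the
printed local definition: for every adèlic oscillator triple `t = (μ, ε, χ)` (p2's `Liu.OscillatorTriple`), every
`z ∈ (A_E^∞)^1` and every vector `w` of `ω(μ, ε, χ)`, the scalar isometry `𝓢.scalar z` acts by `χ(z) = ∏_v χ_v(z_v)`
(p2's `t.χ.toFun z`, the value of the character of `E^1 \ (A_E^∞)^1` of Def. 4.11's third bullet at `z`). The step
from the local factors to the restricted tensor product — `z` acts factorwise on pure tensors by `∏_v χ_v(z_v)`, all
but finitely many `z_v` being units acting trivially on the distinguished unramified vectors — is the [P] paragraph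
of TIER4 §B5 Prop. B5.3(e) (scored PASS), here FOLDED INTO THE DISPLAY because the carriers have no local factors:
STRONGER than the printed local sentence by exactly that bookkeeping, marked. Which elements of `G(A_F^∞)` are the
scalars is the datum `𝓢` (carried into the centre). Consumed by `T6B5Central.lean` (Prop. B5.3(e) at the levels of
`B5_main`; the identification of the printed `χ` with Schur's central character)] -/
def Liu2021_AppD1_Step3 (𝓛 : LiuAlbaneseDatum K c χEF) (𝓢 : ScalarDatum 𝓛) : Prop :=
  ∀ (t : Liu.OscillatorTriple K c χEF) (z : ↥(Liu.oneFinIdeles K c)) (w : 𝓛.W (𝓛.osc t)),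
    𝓛.ω (𝓛.osc t) ((𝓢.scalar z : Subgroup.center 𝓛.G) : 𝓛.G) w = ((t.χ.toFun z : ℂˣ) : ℂ) • w

#check @Liu2021_AppD1_Step3

end Summit.Ventures.HodgeRepro2.T6.Hyp
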